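import Literature.AlgebraicGeometry.Resolution.OrderAlongBranch
import Literature.AlgebraicGeometry.Resolution.CompleteLocalDomainNormalization
import Literature.AlgebraicGeometry.Resolution.AdicCompletionRegular
import Literature.AlgebraicGeometry.Resolution.AdicQuotient
import Literature.AlgebraicGeometry.Resolution.FormalFibres
import Literature.AlgebraicGeometry.Resolution.RegularFormalFibresPolynomial
import Mathlib.RingTheory.Ideal.GoingDown
import Mathlib.RingTheory.AdicCompletion.AsTensorProduct
import HarnessLib

/-!
# Generization lowers the order, I: primes of coheight one

Topic: `Literature/AlgebraicGeometry/Resolution`. Let `(R, 𝔪)` be a regular local ring and `P` a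
prime ideal with `dim R/P = 1`. **Theorem** (`mem_pow_of_coheight_one`): if `x ∈ R` and
`s x ∈ Pⁿ` for some `s ∉ P` (i.e. `x ∈ P⁽ⁿ⁾ = PⁿR_P ∩ R`: the order of `x` at the generic point of
the curve `V(P)` is at least `n`), then `x ∈ 𝔪ⁿ` (the order at the closed point is at least `n`).
This is the pointwise content of the upper semicontinuity of `x ↦ ord_x J` used by
Cossart–Piltant in the proof of Prop. 4.2 of [CoP1] ("`Σ` … is a closed subset of `X`"); for
regular local rings no excellence hypothesis is needed.

## Proof (reduction to a branch of the completed curve)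

Let `R̂` be the `𝔪`-adic completion (again regular local, `AdicCompletionRegular.lean`; flat over
`R`) and `Q` a minimal prime of `PR̂`; by going down `Q ∩ R = P`. The quotient `D = R̂/Q` is a
complete Noetherian local domain of dimension one (`R̂/PR̂ ≅ (R/P)^` has the dimension of `R/P`,
`AdicQuotient.lean`, `ringKrullDim_adicCompletion`; and `Q ≠ 𝔪̂`). By
`CompleteLocalDomainNormalization.lean` its normalization `W` is a discrete valuation ring, finite
over `D`, local over `D`, birational — a branch `f : R̂ → D → W` with `ker f = Q`. From `s x ∈ Pⁿ`,
`s ∉ Q` we get `x/1 ∈ (Q R̂_Q)ⁿ`, so `x ∈ 𝔪̂ⁿ` by the theorem on the order along a branch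
(`OrderAlongBranch.lean`), and `𝔪̂ⁿ ∩ R = 𝔪ⁿ`.

## References

* V. Cossart, O. Piltant, J. Algebra 320 (2008), proof of Prop. 4.2. [cite: CossartPiltant2008, Prop. 4.2 (proof)]
* H. Matsumura, *Commutative Ring Theory*, Thm. 8.11 (`(A/I)^ = Â/IÂ`), §19 (completion of a
  regular local ring). [cite: Matsumura1987, Thm. 8.11]
-/

noncomputable section

open IsLocalRing

namespace Literature.AlgebraicGeometry.Resolution

universe u

/-! ## Auxiliary facts -/

section Aux

/-- `𝔪̂ⁿ ∩ A = 𝔪ⁿ` for the `I`-adic completion: an element of `A` whose image lies in `IⁿÂ`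
lies in `Iⁿ` (compare in `Â/IⁿÂ = A/Iⁿ`). [folklore] -/
theorem mem_pow_of_of_mem_map_pow {A : Type u} [CommRing A] (I : Ideal A) (n : ℕ) {x : A}
    (hx : algebraMap A (AdicCompletion I A) x ∈ (I ^ n).map (algebraMap A (AdicCompletion I A))) :
    x ∈ I ^ n := by
  have h1 : AdicCompletion.of I A x ∈ (I ^ n • ⊤ : Submodule A (AdicCompletion I A)) := by
    rw [Ideal.smul_top_eq_map]
    exact hx
  have h2 := AdicCompletion.pow_smul_top_le_ker_eval (I := I) (M := A) n h1
  rw [LinearMap.mem_ker, AdicCompletion.eval_of, Submodule.mkQ_apply,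
    Submodule.Quotient.mk_eq_zero, smul_eq_mul, Ideal.mul_top] at h2
  exact h2

/-- In a localization at a prime `Q`, `x/1 ∈ (Q S)ⁿ` as soon as `s x ∈ Qⁿ` for some `s ∉ Q`.
[folklore] -/
theorem algebraMap_mem_maximalIdeal_pow_of_mul_mem_pow {A : Type*} [CommRing A] (Q : Ideal A)
    [Q.IsPrime] (S : Type*) [CommRing S] [Algebra A S] [IsLocalization.AtPrime S Q]
    [IsLocalRing S] {n : ℕ} {x s : A} (hs : s ∉ Q) (hsx : s * x ∈ Q ^ n) :
    algebraMap A S x ∈ maximalIdeal S ^ n := by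
  rw [← IsLocalization.AtPrime.map_eq_maximalIdeal Q S, ← Ideal.map_pow]
  have hu : IsUnit (algebraMap A S s) := IsLocalization.map_units S (⟨s, hs⟩ : Q.primeCompl)
  rw [← Ideal.unit_mul_mem_iff_mem _ hu, ← map_mul]
  exact Ideal.mem_map_of_mem _ hsx

/-- Conversely, `x/1 ∈ (P S)ⁿ` gives `s x ∈ Pⁿ` for some `s ∉ P` (domains). [folklore] -/
theorem exists_mul_mem_pow_of_algebraMap_mem_maximalIdeal_pow {A : Type*} [CommRing A] [IsDomain A]
    (P : Ideal A) [P.IsPrime] (S : Type*) [CommRing S] [Algebra A S] [IsLocalization.AtPrime S P]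
    [IsLocalRing S] {n : ℕ} {x : A} (hx : algebraMap A S x ∈ maximalIdeal S ^ n) :
    ∃ s ∉ P, s * x ∈ P ^ n := by
  rw [← IsLocalization.AtPrime.map_eq_maximalIdeal P S, ← Ideal.map_pow,
    IsLocalization.mem_map_algebraMap_iff P.primeCompl S] at hx
  obtain ⟨⟨⟨i, hi⟩, ⟨s, hs⟩⟩, h⟩ := hx
  refine ⟨s, hs, ?_⟩
  have hinj : Function.Injective (algebraMap A S) :=
    IsLocalization.injective (M := P.primeCompl) S (Ideal.primeCompl_le_nonZeroDivisors P)
  have : algebraMap A S (s * x) = algebraMap A S i := by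
    rw [map_mul, mul_comm]; exact h
  rw [hinj this]
  exact hi

end Aux

/-! ## The completed curve -/

section Completion

variable {R : Type u} [CommRing R] [IsRegularLocalRing R] (P : Ideal R) [P.IsPrime]

/-- `dim R̂/PR̂ = dim R/P` for a Noetherian local ring (`R̂/PR̂ ≅ (R/P)^`, Matsumura 8.11, and
`dim (R/P)^ = dim R/P`, Matsumura 15.1). [cite: Matsumura1987, Thm. 8.11] -/
theorem ringKrullDim_adicCompletion_quotient_map {A : Type u} [CommRing A] [IsLocalRing A]
    [IsNoetherianRing A] (p : Ideal A) [p.IsPrime] :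
    ringKrullDim (AdicCompletion (maximalIdeal A) A ⧸
        p.map (algebraMap A (AdicCompletion (maximalIdeal A) A))) = ringKrullDim (A ⧸ p) := by
  haveI : IsLocalRing (A ⧸ p) :=
    IsLocalRing.of_surjective' (Ideal.Quotient.mk p) Ideal.Quotient.mk_surjective
  rw [ringKrullDim_eq_of_ringEquiv (quotientCompletionEquiv (maximalIdeal A) p)]
  have hmax : (maximalIdeal A).map (Ideal.Quotient.mk p) = maximalIdeal (A ⧸ p) :=
    IsLocalRing.map_maximalIdeal_of_surjective _ Ideal.Quotient.mk_surjective
  rw [hmax, ringKrullDim_adicCompletion]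

/-- For a minimal prime `Q` of `PR̂` with `dim R/P = 1`: `Q ∩ R = P` and `dim R̂/Q = 1`.
[folklore] -/
theorem under_eq_and_ringKrullDim_quotient_eq_one (hP : ringKrullDim (R ⧸ P) = 1)
    {Q : Ideal (AdicCompletion (maximalIdeal R) R)}
    (hQ : Q ∈ (P.map (algebraMap R (AdicCompletion (maximalIdeal R) R))).minimalPrimes) :
    Q.under R = P ∧ ringKrullDim (AdicCompletion (maximalIdeal R) R ⧸ Q) = 1 := by
  haveI hQp : Q.IsPrime := hQ.1.1
  haveI : IsNoetherianRing (AdicCompletion (maximalIdeal R) R) :=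
    isNoetherianRing_adicCompletion_maximalIdeal R
  have hunder : Q.under R = P := under_eq_of_mem_minimalPrimes_map P hQ
  refine ⟨hunder, le_antisymm ?_ ?_⟩
  · -- `dim R̂/Q ≤ dim R̂/PR̂ = dim R/P = 1`
    have h1 := ringKrullDim_le_of_surjective (Ideal.Quotient.factor hQ.1.2)
      (Ideal.Quotient.factor_surjective hQ.1.2)
    rw [ringKrullDim_adicCompletion_quotient_map P, hP] at h1
    exact h1
  · -- `Q ≠ 𝔪̂` (as `P ≠ 𝔪`), so the local domain `R̂/Q` is not a field
    haveI : IsLocalRing (AdicCompletion (maximalIdeal R) R ⧸ Q) :=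
      IsLocalRing.of_surjective' (Ideal.Quotient.mk Q) Ideal.Quotient.mk_surjective
    have hQm : Q ≠ maximalIdeal (AdicCompletion (maximalIdeal R) R) := by
      intro hQm
      have h1 : (maximalIdeal (AdicCompletion (maximalIdeal R) R)).under R = maximalIdeal R := by
        rw [Ideal.under_def, AdicCompletion.maximalIdeal_eq_map]
        -- `(𝔪R̂) ∩ R = 𝔪`: `⊇` is clear; `⊆` since it is a proper ideal containing `𝔪`
        refine (IsLocalRing.maximalIdeal.isMaximal R).eq_of_le ?_ ?_ |>.symm
        · rw [Ne, Ideal.comap_eq_top_iff, ← AdicCompletion.maximalIdeal_eq_map]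
          exact (IsLocalRing.maximalIdeal.isMaximal (AdicCompletion (maximalIdeal R) R)).ne_top
        · exact Ideal.le_comap_map
      rw [hQm, h1] at hunder
      have hfield : IsField (R ⧸ P) := by
        rw [← hunder, ← Ideal.Quotient.maximal_ideal_iff_isField_quotient]
        exact IsLocalRing.maximalIdeal.isMaximal R
      have := ringKrullDim_eq_zero_of_isField hfield
      rw [hP] at this
      exact one_ne_zero this
    have hne : maximalIdeal (AdicCompletion (maximalIdeal R) R ⧸ Q) ≠ ⊥ := by
      intro hbot
      apply hQm
      have hmap : (maximalIdeal (AdicCompletion (maximalIdeal R) R)).map (Ideal.Quotient.mk Q) = maximalIdeal (AdicCompletion (maximalIdeal R) R ⧸ Q) :=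
        IsLocalRing.map_maximalIdeal_of_surjective _ Ideal.Quotient.mk_surjective
      rw [hbot, Ideal.map_eq_bot_iff_le_ker, Ideal.mk_ker] at hmap
      exact le_antisymm (IsLocalRing.le_maximalIdeal hQp.ne_top) hmap
    -- a local domain which is not a field has dimension `≥ 1`
    rw [← IsLocalRing.maximalIdeal_height_eq_ringKrullDim]
    have h0 : (maximalIdeal (AdicCompletion (maximalIdeal R) R ⧸ Q)).height ≠ 0 := by
      rw [Ne, Ideal.height_eq_zero_iff, IsDomain.minimalPrimes_eq_singleton_bot,
        Set.mem_singleton_iff]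
      exact hne
    exact_mod_cast Order.one_le_iff_ne_zero.mpr h0

end Completion

/-! ## The theorem -/

/-- **Generization lowers the order (coheight one).** Let `R` be a regular local ring and `P` a
prime ideal with `dim R/P = 1`. If `s x ∈ Pⁿ` for some `s ∉ P` (i.e. `x ∈ PⁿR_P ∩ R`), then
`x ∈ 𝔪ⁿ`: the order of `x` along the curve `V(P)` is at most its order at the closed point.
[cite: CossartPiltant2008, Prop. 4.2 (proof)] -/
theorem mem_pow_of_coheight_one {R : Type u} [CommRing R] [IsRegularLocalRing R] (P : Ideal R)
    [P.IsPrime] (hP : ringKrullDim (R ⧸ P) = 1) {n : ℕ} {x s : R} (hs : s ∉ P)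
    (hsx : s * x ∈ P ^ n) : x ∈ maximalIdeal R ^ n := by
  -- the completion `R̂` and a minimal prime `Q` of `PR̂`
  haveI : IsRegularLocalRing (AdicCompletion (maximalIdeal R) R) := isRegularLocalRing_adicCompletion R
  haveI : IsNoetherianRing (AdicCompletion (maximalIdeal R) R) := inferInstance
  set PR := P.map (algebraMap R (AdicCompletion (maximalIdeal R) R)) with hPR
  have hPRle : PR ≤ maximalIdeal (AdicCompletion (maximalIdeal R) R) := by
    rw [hPR, AdicCompletion.maximalIdeal_eq_map]
    exact Ideal.map_mono (IsLocalRing.le_maximalIdeal (Ideal.IsPrime.ne_top ‹_›))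
  obtain ⟨Q, hQmin, -⟩ := Ideal.exists_minimalPrimes_le hPRle
  haveI hQp : Q.IsPrime := hQmin.1.1
  obtain ⟨hunder, hdimD⟩ := under_eq_and_ringKrullDim_quotient_eq_one P hP hQmin
  -- the complete local domain `D = R̂/Q` and its normalization `W`
  haveI : IsLocalRing (AdicCompletion (maximalIdeal R) R ⧸ Q) :=
    IsLocalRing.of_surjective' (Ideal.Quotient.mk Q) Ideal.Quotient.mk_surjective
  haveI : IsAdicComplete (maximalIdeal (AdicCompletion (maximalIdeal R) R ⧸ Q))
      (AdicCompletion (maximalIdeal R) R ⧸ Q) := isAdicComplete_quotient Q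
  set D := AdicCompletion (maximalIdeal R) R ⧸ Q with hD
  haveI : IsLocalRing (integralClosure D (FractionRing D)) :=
    isLocalRing_integralClosure_of_complete D hdimD
  haveI : IsDiscreteValuationRing (integralClosure D (FractionRing D)) :=
    isDiscreteValuationRing_integralClosure_of_complete D hdimD
  haveI hfinDW : Module.Finite D (integralClosure D (FractionRing D)) :=
    module_finite_integralClosure_of_complete D hdimD
  haveI : IsLocalHom (algebraMap D (integralClosure D (FractionRing D))) :=
    isLocalHom_algebraMap_integralClosure D
  -- the branch `f : R̂ → W`
  set f : AdicCompletion (maximalIdeal R) R →+* integralClosure D (FractionRing D) :=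
    (algebraMap D (integralClosure D (FractionRing D))).comp (Ideal.Quotient.mk Q) with hf
  have hfa : ∀ y, f y = algebraMap D _ (Ideal.Quotient.mk Q y) := fun y => rfl
  have hWinj : Function.Injective (algebraMap D (integralClosure D (FractionRing D))) :=
    fun a b h => IsFractionRing.injective D (FractionRing D)
      (congrArg (fun z : integralClosure D (FractionRing D) => (z : FractionRing D)) h)
  haveI : IsLocalHom f := by
    refine ((IsLocalRing.local_hom_TFAE f).out 0 2).mpr ?_
    rw [hf, ← Ideal.map_map, IsLocalRing.map_maximalIdeal_of_surjective _ Ideal.Quotient.mk_surjective]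
    exact ((IsLocalRing.local_hom_TFAE (algebraMap D (integralClosure D (FractionRing D)))).out 0 2).mp
      ‹IsLocalHom (algebraMap D (integralClosure D (FractionRing D)))›
  have hfin : f.Finite :=
    RingHom.Finite.comp (RingHom.finite_algebraMap.mpr hfinDW)
      (RingHom.Finite.of_surjective _ Ideal.Quotient.mk_surjective)
  have hbir : ∀ w : integralClosure D (FractionRing D), ∃ a b, f b ≠ 0 ∧ w * f b = f a := by
    intro w
    obtain ⟨a, b, hb, hab⟩ := exists_mul_algebraMap_eq_of_mem_integralClosure D w
    obtain ⟨a, rfl⟩ := Ideal.Quotient.mk_surjective a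
    obtain ⟨b, rfl⟩ := Ideal.Quotient.mk_surjective b
    exact ⟨a, b, hb, hab⟩
  have hker : RingHom.ker f = Q := by
    ext y
    rw [RingHom.mem_ker, hfa, ← map_zero (algebraMap D (integralClosure D (FractionRing D))),
      hWinj.eq_iff, Ideal.Quotient.eq_zero_iff_mem]
  -- `x/1 ∈ (Q R̂_Q)^n`
  have hsQ : algebraMap R (AdicCompletion (maximalIdeal R) R) s ∉ Q := by
    intro h
    apply hs
    have : s ∈ Q.under R := h
    rwa [hunder] at this
  have hsxQ : algebraMap R _ s * algebraMap R (AdicCompletion (maximalIdeal R) R) x ∈ Q ^ n := by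
    rw [← map_mul]
    exact Ideal.pow_right_mono hQmin.1.2 n (by rw [← Ideal.map_pow]; exact Ideal.mem_map_of_mem _ hsx)
  have hxS := algebraMap_mem_maximalIdeal_pow_of_mul_mem_pow Q (Localization.AtPrime Q) hsQ hsxQ
  -- the branch theorem
  have hmem := mem_pow_of_algebraMap_mem_pow_of_branch f hfin hbir Q hker (Localization.AtPrime Q) hxS
  -- back to `R`
  rw [AdicCompletion.maximalIdeal_eq_map, ← Ideal.map_pow] at hmem
  exact mem_pow_of_of_mem_map_pow (maximalIdeal R) n hmem

end Literature.AlgebraicGeometry.Resolution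

end
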